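import Literature.NumberTheory.Automorphic.Liu2021.AppendixC.AlbaneseFunctorial
import Literature.NumberTheory.Automorphic.Liu2021.NablaGaloisDescent
import Literature.AlgebraicGeometry.Motives.AbelianVarietyConjugateComp
import Literature.AlgebraicGeometry.Motives.AbelianVarietyBaseChangeSchemeMaps
import HarnessLib

/-!
# Liu 2021 Def. 2.1 (1) / Def. 2.3 under CONJUGATION by a field automorphism: `∇(X^τ) = (∇X)^τ`, `Alb_{X^τ} = (Alb_X)^τ`

For a field `L`, an automorphism `τ ∈ Aut(L)` and an `L`-scheme `X`, the twist `X^τ = X ×_{Spec L, Spec τ} Spec L` (the tree's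
`AbelianVariety.bcFunctor L (AlongHom L τ.toRingHom) = Over.pullback (Spec τ)`, underlying `AbelianVariety.conjugate τ` and `Motives.conjugateVariety τ`)
is base change along an ISOMORPHISM, so every construction of [Liu2021, §2.1] is carried along it FORMALLY (no descent, no
[FGA VI 3.3 (iii)]): the smallest clopen subscheme of `X × X` containing the diagonal (`AppendixC.Nabla`, Def. 2.1 (1)) and the
Albanese datum (`AppendixC.Albanese`, Def. 2.3: `α_X : ∇X → Alb_X` corepresenting `A ↦ {f : ∇X → A ∣ ΔX ⊆ f⁻¹0_A}`).

* `Nabla.conjugate τ N : Nabla (X^τ)` — `(∇X)^τ ↪ (X × X)^τ ≅ X^τ × X^τ`; minimality by transport of clopen subsets along the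
  scheme isomorphism `X^τ → X` (first projection).
* `Nabla.conjugate_map` — `∇(u^τ) = (∇u)^τ`.
* `Albanese.conjugate τ a : Albanese (X^τ)` — `Alb := (Alb_X)^τ` (`AbelianVariety.conjugate`), `α := α^τ`; the universal property is
  transported through the inverse twist `τ⁻¹` and the canonical `(B^{τ⁻¹})^τ ≅ B` (★ `AbelianVarietyConjugateComp`).
* `Albanese.conjugate_map` — **`(Alb_u)^τ = Alb_{u^τ}`** for the conjugated data (uniqueness in Def. 2.3).

DEFINITIONS WITH BODIES and THEOREMS; no named fact, no instance, no `sorry`.  Milne 2005 §11 p. 108: «a homomorphism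
`σ : k → Ω` defines a functor `V ↦ σV`»; here `σ` is an automorphism and the functor is an equivalence.
Cell `hodgecm-mathlib` (D-0151), A-p13 (g18): the scheme-level input of the K2 transport (`AlbConjDatum` of
`CorCM/HypLiu418/A3Liu418GSConjugateTransport`).  HC_CM is proved only modulo the 7 printed citations until rung 0 closes.

## References
* [Liu2021] Y. Liu, *Fourier–Jacobi cycles and arithmetic relative trace formula*, Camb. J. Math. 9 (2021), §2.1 Def. 2.1 (1)
  (FJcycle.tex l. 1171–1176), Def. 2.3 (l. 1202–1208).
* [GortzWedhorn2020] U. Görtz, T. Wedhorn, *Algebraic Geometry I*, 2nd ed. (2020), §(4.7), Prop. 4.16, Prop. 4.32.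
* [Milne2005ShimuraVarieties] J. S. Milne, *Introduction to Shimura varieties* (2005), §11 p. 108 («the functor σ»).
-/

set_option autoImplicit false

noncomputable section

open CategoryTheory CategoryTheory.Limits AlgebraicGeometry MonoidalCategory CartesianMonoidalCategory
open Literature.AlgebraicGeometry.Motives
open Literature.AlgebraicGeometry.Motives.AbelianVariety (twistFunctor specRingEquiv bcFunctor bcSpec)

universe u

namespace Literature.NumberTheory.Automorphic.Liu2021.AppendixC

set_option backward.isDefEq.respectTransparency false

variable {L : Type u} [Field L] (τ : L ≃+* L)

/-! ## §0 The twist along an automorphism, on underlying schemes: the first projection `X^τ → X` is an isomorphism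

Throughout, the twist functor is spelled `bcFunctor L (AlongHom L τ.toRingHom) = Over.pullback (bcSpec L (AlongHom L τ.toRingHom))`
— base change to `L` made an `L`-algebra through `τ` — which is the spelling underlying `AbelianVariety.conjugate τ` ON THE NOSE
(★ `bcFunctor L (AlongHom L τ.toRingHom)` and ★ `baseChangeHom τ.toRingHom` are the same functor by `rfl`). -/

section Scheme

/-- `Spec τ` in the `AlongHom` spelling is `Spec τ` (`rfl`). [cite: GortzWedhorn2020, §(4.7)] -/
theorem bcSpec_alongHom_eq : bcSpec L (AlongHom L τ.toRingHom) = specRingEquiv τ := rfl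

/-- `Spec τ ≫ Spec τ⁻¹ = 𝟙`. [cite: GortzWedhorn2020, §(4.7)] -/
theorem bcSpec_comp_symm : bcSpec L (AlongHom L τ.toRingHom) ≫ bcSpec L (AlongHom L τ.symm.toRingHom) = 𝟙 _ := by
  rw [bcSpec_alongHom_eq, bcSpec_alongHom_eq,
    ← AbelianVariety.specRingEquiv_eq_comp_of_forall τ.symm τ (RingEquiv.refl L) fun x => (τ.apply_symm_apply x).symm]
  exact AbelianVariety.specRingEquiv_refl

/-- `Spec τ` is an isomorphism. [cite: GortzWedhorn2020, §(4.7)] -/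
theorem isIso_bcSpec : IsIso (bcSpec L (AlongHom L τ.toRingHom)) := by
  rw [bcSpec_alongHom_eq]
  exact AbelianVariety.isIso_specMap_ringEquiv τ

/-- The first projection `X^τ → X` is an isomorphism of schemes (base change of the isomorphism `Spec τ`).
[cite: GortzWedhorn2020, §(4.7)] -/
theorem isIso_fst_twist (X : SchemeOver L) : IsIso (pullback.fst X.hom (bcSpec L (AlongHom L τ.toRingHom))) := by
  haveI := isIso_bcSpec τ
  infer_instance

/-- `(f^τ) ≫ pr_Y = pr_X ≫ f` on underlying schemes. [cite: GortzWedhorn2020, Prop. 4.16] -/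
@[reassoc]
theorem twist_map_left_comp_fst {X Y : SchemeOver L} (f : X ⟶ Y) :
    ((bcFunctor L (AlongHom L τ.toRingHom)).map f).left ≫ pullback.fst Y.hom (bcSpec L (AlongHom L τ.toRingHom)) =
      pullback.fst X.hom (bcSpec L (AlongHom L τ.toRingHom)) ≫ f.left :=
  pullback.lift_fst _ _ _

/-- The structure map of `X^τ` through the first projection: `pr_X ≫ (X → Spec L) ≫ Spec τ⁻¹ = (X^τ → Spec L)`.
[cite: GortzWedhorn2020, §(4.7)] -/
theorem fst_comp_hom_comp_bcSpec_symm (X : SchemeOver L) :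
    pullback.fst X.hom (bcSpec L (AlongHom L τ.toRingHom)) ≫ X.hom ≫ bcSpec L (AlongHom L τ.symm.toRingHom) =
      ((bcFunctor L (AlongHom L τ.toRingHom)).obj X).hom := by
  rw [← Category.assoc, pullback.condition, Category.assoc, bcSpec_comp_symm, Category.comp_id]
  rfl

/-- The image of `f^τ` is the preimage of the image of `f` under the first projection. [cite: GortzWedhorn2020, Prop. 4.16 and Lemma 4.28] -/
theorem range_twist_map_left {X Y : SchemeOver L} (f : X ⟶ Y) :
    Set.range ⇑((bcFunctor L (AlongHom L τ.toRingHom)).map f).left =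
      ⇑(pullback.fst Y.hom (bcSpec L (AlongHom L τ.toRingHom))) ⁻¹' Set.range ⇑f.left :=
  GaloisDescent.range_bcFunctor_map_left (AlongHom L τ.toRingHom) f

end Scheme

/-! ## §1 `∇(X^τ) = (∇X)^τ` (Def. 2.1 (1) under conjugation) -/

namespace Nabla

variable {X Y : SchemeOver L}

/-- The inclusion `(∇X)^τ ↪ (X × X)^τ ⥲ X^τ × X^τ`. [cite: Liu2021, §2.1 Def. 2.1 (1), l. 1174] -/
def conjugateIncl (N : Nabla X) : (bcFunctor L (AlongHom L τ.toRingHom)).obj N.N ⟶ (bcFunctor L (AlongHom L τ.toRingHom)).obj X ⊗ (bcFunctor L (AlongHom L τ.toRingHom)).obj X :=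
  (bcFunctor L (AlongHom L τ.toRingHom)).map N.incl ≫ Functor.OplaxMonoidal.δ (bcFunctor L (AlongHom L τ.toRingHom)) X X

/-- It is an open immersion. [cite: GortzWedhorn2020, Prop. 4.32] -/
theorem isOpenImmersion_conjugateIncl (N : Nabla X) : IsOpenImmersion (conjugateIncl τ N).left := by
  haveI : IsOpenImmersion N.incl.left := N.isOpenImmersion_incl
  haveI := GaloisDescent.isOpenImmersion_bcFunctor_map_left (AlongHom L τ.toRingHom) N.incl
  haveI : IsIso (Functor.OplaxMonoidal.δ (bcFunctor L (AlongHom L τ.toRingHom)) X X).left :=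
    ((Over.forget _).mapIso (Functor.Monoidal.μIso (bcFunctor L (AlongHom L τ.toRingHom)) X X)).isIso_inv
  rw [conjugateIncl, Over.comp_left]
  infer_instance

/-- It is a closed immersion. [cite: GortzWedhorn2020, Prop. 4.32] -/
theorem isClosedImmersion_conjugateIncl (N : Nabla X) : IsClosedImmersion (conjugateIncl τ N).left := by
  haveI : IsClosedImmersion N.incl.left := N.isClosedImmersion_incl
  haveI := GaloisDescent.isClosedImmersion_bcFunctor_map_left (AlongHom L τ.toRingHom) N.incl
  haveI : IsIso (Functor.OplaxMonoidal.δ (bcFunctor L (AlongHom L τ.toRingHom)) X X).left :=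
    ((Over.forget _).mapIso (Functor.Monoidal.μIso (bcFunctor L (AlongHom L τ.toRingHom)) X X)).isIso_inv
  rw [conjugateIncl, Over.comp_left]
  infer_instance

/-- `Δ(X^τ) = (ΔX)^τ` read in `X^τ × X^τ`. [cite: Liu2021, §2.1 Def. 2.1 (1), l. 1174] -/
theorem twist_map_diag_comp_δ (X : SchemeOver L) :
    (bcFunctor L (AlongHom L τ.toRingHom)).map (lift (𝟙 X) (𝟙 X)) ≫ Functor.OplaxMonoidal.δ (bcFunctor L (AlongHom L τ.toRingHom)) X X =
      lift (𝟙 ((bcFunctor L (AlongHom L τ.toRingHom)).obj X)) (𝟙 ((bcFunctor L (AlongHom L τ.toRingHom)).obj X)) := by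
  rw [Functor.OplaxMonoidal.lift_δ, CategoryTheory.Functor.map_id]

/-- **`(∇X)^τ` is contained in every clopen subscheme of `X^τ × X^τ` containing the diagonal** (transport of the minimality of
`∇X` along the scheme isomorphism `X^τ → X`: the clopen subset is carried to a clopen subset of `X × X` containing `ΔX`, cut out
as an open subscheme, to which Def. 2.1 (1) applies). [cite: Liu2021, §2.1 Def. 2.1 (1), l. 1174] [cite: GortzWedhorn2020, Prop. 4.16] -/
theorem range_conjugateIncl_subset (N : Nabla X) (W : SchemeOver L)
    (j : W ⟶ (bcFunctor L (AlongHom L τ.toRingHom)).obj X ⊗ (bcFunctor L (AlongHom L τ.toRingHom)).obj X) (hjo : IsOpenImmersion j.left) (hjc : IsClosedImmersion j.left)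
    (d : (bcFunctor L (AlongHom L τ.toRingHom)).obj X ⟶ W) (hd : d ≫ j = lift (𝟙 _) (𝟙 _)) :
    Set.range ⇑(conjugateIncl τ N).left ⊆ Set.range ⇑j.left := by
  -- notation-free abbreviations
  haveI hμ : IsIso (Functor.LaxMonoidal.μ (bcFunctor L (AlongHom L τ.toRingHom)) X X).left :=
    ((Over.forget _).mapIso (Functor.Monoidal.μIso (bcFunctor L (AlongHom L τ.toRingHom)) X X)).isIso_hom
  haveI hδ : IsIso (Functor.OplaxMonoidal.δ (bcFunctor L (AlongHom L τ.toRingHom)) X X).left :=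
    ((Over.forget _).mapIso (Functor.Monoidal.μIso (bcFunctor L (AlongHom L τ.toRingHom)) X X)).isIso_inv
  haveI := isIso_fst_twist τ (X ⊗ X)
  -- the clopen `j' := j ≫ μ : W ↪ (X × X)^τ` and its shadow `W₀ ⊆ X × X` under the homeomorphism `pr : (X × X)^τ → X × X`
  let π : ((bcFunctor L (AlongHom L τ.toRingHom)).obj (X ⊗ X)).left ⟶ (X ⊗ X).left := pullback.fst (X ⊗ X).hom (bcSpec L (AlongHom L τ.toRingHom))
  let πh : ((bcFunctor L (AlongHom L τ.toRingHom)).obj (X ⊗ X)).left ≃ₜ (X ⊗ X).left := (Scheme.homeoOfIso (asIso π))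
  have hπh : ∀ z, πh z = π z := fun z => rfl
  let j' : W ⟶ (bcFunctor L (AlongHom L τ.toRingHom)).obj (X ⊗ X) := j ≫ Functor.LaxMonoidal.μ (bcFunctor L (AlongHom L τ.toRingHom)) X X
  haveI hjo' : IsOpenImmersion j'.left := by
    change IsOpenImmersion (j ≫ Functor.LaxMonoidal.μ (bcFunctor L (AlongHom L τ.toRingHom)) X X).left
    rw [Over.comp_left]; infer_instance
  haveI hjc' : IsClosedImmersion j'.left := by
    change IsClosedImmersion (j ≫ Functor.LaxMonoidal.μ (bcFunctor L (AlongHom L τ.toRingHom)) X X).left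
    rw [Over.comp_left]; infer_instance
  let V : Set ((bcFunctor L (AlongHom L τ.toRingHom)).obj (X ⊗ X)).left := Set.range ⇑j'.left
  have hV : IsClopen V := ⟨j'.left.isClosedEmbedding.isClosed_range, j'.left.isOpenEmbedding.isOpen_range⟩
  let W₀ : Set (X ⊗ X).left := ⇑πh.symm ⁻¹' V
  have hW₀ : IsClopen W₀ := hV.preimage πh.symm.continuous
  have hW₀' : ∀ S : Set (X ⊗ X).left, ⇑π ⁻¹' S ⊆ V → S ⊆ W₀ := by
    intro S hS x hx
    change πh.symm x ∈ V
    exact hS (show π (πh.symm x) ∈ S by rw [← hπh, πh.apply_symm_apply]; exact hx)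
  -- `ΔX ⊆ W₀`: `(ΔX)^τ = Δ(X^τ) ≫ μ` factors through `j'`
  have hΔ : Set.range ⇑(lift (𝟙 X) (𝟙 X)).left ⊆ W₀ := by
    refine hW₀' _ ?_
    change ⇑(pullback.fst (X ⊗ X).hom (bcSpec L (AlongHom L τ.toRingHom))) ⁻¹' _ ⊆ V
    rw [← range_twist_map_left]
    have e : (bcFunctor L (AlongHom L τ.toRingHom)).map (lift (𝟙 X) (𝟙 X)) = d ≫ j' := by
      change _ = d ≫ j ≫ _
      rw [← Category.assoc, hd, ← twist_map_diag_comp_δ, Category.assoc, Functor.Monoidal.δ_μ, Category.comp_id]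
    have e' : ((bcFunctor L (AlongHom L τ.toRingHom)).map (lift (𝟙 X) (𝟙 X))).left = d.left ≫ j'.left := by rw [e]; rfl
    rintro _ ⟨x, rfl⟩
    exact ⟨d.left x, by rw [e', Scheme.Hom.comp_apply]⟩
  -- the open subscheme of `X × X` on `W₀` is a clopen subscheme containing `ΔX`, so it contains `∇X` (Def. 2.1 (1))
  let U : (X ⊗ X).left.Opens := ⟨W₀, hW₀.2⟩
  have hrange : Set.range ⇑U.ι = W₀ := Scheme.Opens.range_ι U
  haveI hUc : IsClosedImmersion U.ι := IsClosedImmersion.of_isPreimmersion _ (by simpa only [hrange] using hW₀.1)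
  have hΔU : Set.range ⇑(lift (𝟙 X) (𝟙 X)).left ⊆ Set.range ⇑U.ι := hΔ.trans hrange.symm.subset
  obtain ⟨dX, hfac⟩ : ∃ dX : X.left ⟶ U, dX ≫ U.ι = (lift (𝟙 X) (𝟙 X)).left :=
    ⟨IsOpenImmersion.lift U.ι (lift (𝟙 X) (𝟙 X)).left hΔU, IsOpenImmersion.lift_fac _ _ _⟩
  obtain ⟨f₀, hf₀⟩ := N.minimal (Over.mk (U.ι ≫ (X ⊗ X).hom)) (Over.homMk U.ι rfl)
    (inferInstanceAs (IsOpenImmersion U.ι)) hUc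
    ⟨Over.homMk dX (by
        change dX ≫ U.ι ≫ (X ⊗ X).hom = X.hom
        rw [← Category.assoc, hfac]
        exact Over.w (lift (𝟙 X) (𝟙 X))), Over.OverMorphism.ext hfac⟩
  have hN : Set.range ⇑N.incl.left ⊆ W₀ := by
    rw [← hrange, ← hf₀, Over.comp_left]
    rintro _ ⟨z, rfl⟩
    exact ⟨f₀.left z, rfl⟩
  -- transport back: `(∇X)^τ ⊆ pr⁻¹ W₀ = V = im j'`, then compose with `δ`
  have hN' : Set.range ⇑((bcFunctor L (AlongHom L τ.toRingHom)).map N.incl).left ⊆ V := by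
    rw [range_twist_map_left]
    intro z hz
    have hz' : πh z ∈ W₀ := hN hz
    change πh.symm (πh z) ∈ V at hz'
    rwa [πh.symm_apply_apply] at hz'
  rintro _ ⟨z, rfl⟩
  obtain ⟨w, hw⟩ := hN' ⟨z, rfl⟩
  refine ⟨w, ?_⟩
  have hj : j = j' ≫ Functor.OplaxMonoidal.δ (bcFunctor L (AlongHom L τ.toRingHom)) X X := by
    change j = (j ≫ _) ≫ _
    rw [Category.assoc, Functor.Monoidal.μ_δ, Category.comp_id]
  rw [hj, Over.comp_left, Scheme.Hom.comp_apply, hw, conjugateIncl, Over.comp_left, Scheme.Hom.comp_apply]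

/-- **`∇(X^τ) := (∇X)^τ`** — the conjugate of a `∇X` is a `∇` of the conjugate (Def. 2.1 (1) is stable under the base change along
the isomorphism `Spec τ`: clopen immersions and the diagonal are, and minimality transports along `X^τ ≅ X`).
[cite: Liu2021, §2.1 Def. 2.1 (1), l. 1171–1176] [cite: GortzWedhorn2020, Prop. 4.16 and Prop. 4.32] -/
def conjugate (N : Nabla X) : Nabla ((bcFunctor L (AlongHom L τ.toRingHom)).obj X) where
  N := (bcFunctor L (AlongHom L τ.toRingHom)).obj N.N
  incl := conjugateIncl τ N
  isOpenImmersion_incl := isOpenImmersion_conjugateIncl τ N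
  isClosedImmersion_incl := isClosedImmersion_conjugateIncl τ N
  diag := (bcFunctor L (AlongHom L τ.toRingHom)).map N.diag
  diag_incl := by
    rw [conjugateIncl, ← Category.assoc, ← Functor.map_comp, N.diag_incl, twist_map_diag_comp_δ]
  minimal W j hjo hjc hδ := by
    obtain ⟨d, hd⟩ := hδ
    haveI := hjo
    have hsub := range_conjugateIncl_subset τ N W j hjo hjc d hd
    refine ⟨Over.homMk (IsOpenImmersion.lift j.left (conjugateIncl τ N).left hsub) ?_, ?_⟩
    · rw [← Over.w j, ← Category.assoc, IsOpenImmersion.lift_fac]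
      exact Over.w (conjugateIncl τ N)
    · exact Over.OverMorphism.ext (IsOpenImmersion.lift_fac _ _ _)

/-- The scheme of `∇(X^τ)` is `(∇X)^τ` (`rfl`). [cite: Liu2021, §2.1 Def. 2.1 (1)] -/
theorem conjugate_N (N : Nabla X) : (N.conjugate τ).N = (bcFunctor L (AlongHom L τ.toRingHom)).obj N.N := rfl

/-- Its inclusion is `(∇X ↪ X × X)^τ ≫ δ` (`rfl`). [cite: Liu2021, §2.1 Def. 2.1 (1)] -/
theorem conjugate_incl (N : Nabla X) :
    (N.conjugate τ).incl = (bcFunctor L (AlongHom L τ.toRingHom)).map N.incl ≫ Functor.OplaxMonoidal.δ (bcFunctor L (AlongHom L τ.toRingHom)) X X := rfl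

/-- Its diagonal is `(ΔX)^τ` (`rfl`). [cite: Liu2021, §2.1 Def. 2.1 (1)] -/
theorem conjugate_diag (N : Nabla X) : (N.conjugate τ).diag = (bcFunctor L (AlongHom L τ.toRingHom)).map N.diag := rfl

/-- **`∇(u^τ) = (∇u)^τ`**: the restriction of `u^τ × u^τ` to the conjugated `∇`'s is the conjugate of `∇u` (uniqueness,
`Nabla.map_unique`, and naturality of `δ`). [cite: Liu2021, §2.1 Def. 2.1 (1), l. 1176] -/
theorem conjugate_map (N' : Nabla Y) (N : Nabla X) (u : Y ⟶ X) :
    (N'.conjugate τ).map (N.conjugate τ) ((bcFunctor L (AlongHom L τ.toRingHom)).map u) = (bcFunctor L (AlongHom L τ.toRingHom)).map (N'.map N u) := by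
  symm
  refine Nabla.map_unique (N'.conjugate τ) (N.conjugate τ) ((bcFunctor L (AlongHom L τ.toRingHom)).map u) _ ?_
  rw [conjugate_incl, conjugate_incl, ← Category.assoc, ← Functor.map_comp, Nabla.map_incl, Functor.map_comp,
    Category.assoc, Category.assoc, ← Functor.OplaxMonoidal.δ_natural]

end Nabla

/-! ## §2 Scheme-level bookkeeping for the conjugate abelian variety and the inverse twist -/

section Bookkeeping

open scoped MonObj Obj

variable {X Y : SchemeOver L}

/-- `(f^τ)` on underlying schemes is `pr_X ≫ f ≫ pr_Y⁻¹`. [cite: GortzWedhorn2020, Prop. 4.16] -/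
theorem twist_map_left_eq (f : X ⟶ Y) :
    haveI := isIso_fst_twist τ Y
    ((bcFunctor L (AlongHom L τ.toRingHom)).map f).left =
      pullback.fst X.hom (bcSpec L (AlongHom L τ.toRingHom)) ≫ f.left ≫ inv (pullback.fst Y.hom (bcSpec L (AlongHom L τ.toRingHom))) := by
  haveI := isIso_fst_twist τ Y
  rw [← Category.assoc, IsIso.eq_comp_inv, twist_map_left_comp_fst]

/-- The constant morphism at the unit on underlying schemes: `(1 : T → B).left = (T → Spec L) ≫ e_B`. [folklore] -/
private theorem one_left (T : SchemeOver L) (B : AbelianVariety L) : (1 : T ⟶ B.X).left = T.hom ≫ (η[B.X]).left := by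
  rw [Hom.one_def, Over.comp_left]
  exact congrArg (· ≫ (η[B.X]).left) ((Category.comp_id _).symm.trans (Over.w (toUnit T)))

/-- The unit of `B^τ` followed by `pr₁ : B^τ → B` is `Spec τ ≫ e_B` (★ `AbelianVariety.one_conjugate_left_comp_fst`, restated
with `pullback.fst`). [cite: Milne2005ShimuraVarieties, §11 p. 108 («σV»)] -/
theorem one_conjugate_left_comp_fst (B : AbelianVariety L) :
    (η[(B.conjugate τ).X]).left ≫ pullback.fst B.X.hom (bcSpec L (AlongHom L τ.toRingHom)) =
      bcSpec L (AlongHom L τ.toRingHom) ≫ (η[B.X]).left :=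
  AbelianVariety.one_baseChange_left_comp_fst (AlongHom L τ.toRingHom) B

/-- `(1 : T → B^τ).left ≫ pr₁ = (T → Spec L) ≫ Spec τ ≫ e_B`. [cite: Milne2005ShimuraVarieties, §11 p. 108 («σV»)] -/
theorem one_conjugate_left_comp_fst' (T : SchemeOver L) (B : AbelianVariety L) :
    (1 : T ⟶ (B.conjugate τ).X).left ≫ pullback.fst B.X.hom (bcSpec L (AlongHom L τ.toRingHom)) =
      T.hom ≫ bcSpec L (AlongHom L τ.toRingHom) ≫ (η[B.X]).left := by
  rw [one_left, Category.assoc, one_conjugate_left_comp_fst]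

/-- **The twist functor preserves the constant morphism at the unit**: `(1 : T → B)^τ = (1 : T^τ → B^τ)`.
[cite: Milne2005ShimuraVarieties, §11 p. 108 («the functor σ»)] -/
theorem twist_map_one (T : SchemeOver L) (B : AbelianVariety L) :
    (bcFunctor L (AlongHom L τ.toRingHom)).map (1 : T ⟶ B.X) = (1 : (bcFunctor L (AlongHom L τ.toRingHom)).obj T ⟶ (B.conjugate τ).X) := by
  apply Over.OverMorphism.ext
  apply pullback.hom_ext
  · rw [twist_map_left_comp_fst, one_left, ← Category.assoc, pullback.condition, Category.assoc]
    exact (one_conjugate_left_comp_fst' τ ((bcFunctor L (AlongHom L τ.toRingHom)).obj T) B).symm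
  · exact (Over.w ((bcFunctor L (AlongHom L τ.toRingHom)).map (1 : T ⟶ B.X))).trans
      (Over.w (1 : (bcFunctor L (AlongHom L τ.toRingHom)).obj T ⟶ (B.conjugate τ).X)).symm

/-- **Conjugation is faithful on homomorphisms** (`f^τ ≫ pr = pr ≫ f` with `pr` an isomorphism).
[cite: Milne2005ShimuraVarieties, §11 p. 108 («the functor σ»)] -/
theorem conjugate_hom_injective {A B : AbelianVariety L} (ψ₁ ψ₂ : A ⟶ B)
    (h : AbelianVariety.Hom.conjugate τ ψ₁ = AbelianVariety.Hom.conjugate τ ψ₂) : ψ₁ = ψ₂ := by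
  haveI := isIso_fst_twist τ A.X
  apply AbelianVariety.hom_ext
  apply Over.OverMorphism.ext
  have h1 := AbelianVariety.toSchemeHom_baseChange_comp_fst (AlongHom L τ.toRingHom) ψ₁
  have h2 := AbelianVariety.toSchemeHom_baseChange_comp_fst (AlongHom L τ.toRingHom) ψ₂
  change AbelianVariety.Hom.toSchemeHom (AbelianVariety.Hom.conjugate τ ψ₁) ≫ _ =
    pullback.fst A.X.hom (bcSpec L (AlongHom L τ.toRingHom)) ≫ _ at h1
  change AbelianVariety.Hom.toSchemeHom (AbelianVariety.Hom.conjugate τ ψ₂) ≫ _ =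
    pullback.fst A.X.hom (bcSpec L (AlongHom L τ.toRingHom)) ≫ _ at h2
  rw [h] at h1
  exact (cancel_epi (pullback.fst A.X.hom (bcSpec L (AlongHom L τ.toRingHom)))).1 (h1.symm.trans h2)

/-- **`(B^τ)^σ ≅ B` for `σ ∘ τ = id`, with its formula on schemes `pr_σ ≫ pr_τ`** (★ `exists_iso_conjugate_conjugate` at
`ρ = id` composed with ★ `exists_iso_conjugate_refl`, keeping the first-projection formulas).
[cite: Milne2005ShimuraVarieties, §11 p. 108 («the functor σ»)] [cite: GortzWedhorn2020, Prop. 4.16] -/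
theorem exists_iso_conjugate_conjugate_of_inverse_fst (τ σ : L ≃+* L) (h : ∀ x, σ (τ x) = x) :
    ∃ e : ∀ B : AbelianVariety L, (B.conjugate τ).conjugate σ ≅ B,
      ∀ B : AbelianVariety L, AbelianVariety.Hom.toSchemeHom (e B).hom =
        pullback.fst ((B.conjugate τ).X).hom (bcSpec L (AlongHom L σ.toRingHom)) ≫ pullback.fst B.X.hom (bcSpec L (AlongHom L τ.toRingHom)) := by
  obtain ⟨e₁, he₁, -, -⟩ :=
    AbelianVariety.exists_iso_conjugate_conjugate τ σ (RingEquiv.refl L) fun x => (h x).symm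
  obtain ⟨e₂, he₂, -, -⟩ := AbelianVariety.exists_iso_conjugate_refl (L := L)
  refine ⟨fun B => e₁ B ≪≫ e₂ B, fun B => ?_⟩
  change AbelianVariety.Hom.toSchemeHom (e₁ B).hom ≫ AbelianVariety.Hom.toSchemeHom (e₂ B).hom = _
  rw [he₂]
  exact he₁ B

/-- A CHOSEN natural family `c_B : (B^{τ⁻¹})^τ ≅ B` with `c_B = pr ≫ pr` on schemes. [cite: Milne2005ShimuraVarieties, §11 p. 108] -/
def conjConjIso (B : AbelianVariety L) : (B.conjugate τ.symm).conjugate τ ≅ B :=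
  (exists_iso_conjugate_conjugate_of_inverse_fst τ.symm τ τ.apply_symm_apply).choose B

/-- Its formula on schemes. [cite: GortzWedhorn2020, Prop. 4.16] -/
theorem toSchemeHom_conjConjIso_hom (B : AbelianVariety L) :
    AbelianVariety.Hom.toSchemeHom (conjConjIso τ B).hom =
      pullback.fst ((B.conjugate τ.symm).X).hom (bcSpec L (AlongHom L τ.toRingHom)) ≫ pullback.fst B.X.hom (bcSpec L (AlongHom L τ.symm.toRingHom)) :=
  (exists_iso_conjugate_conjugate_of_inverse_fst τ.symm τ τ.apply_symm_apply).choose_spec B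

/-- **Transport of a morphism `f : N^τ → B` to `f♭ : N → B^{τ⁻¹}`** (`x ↦ f(pr⁻¹ x)` over `Spec τ⁻¹`): the adjunct along the
equivalence «twist by `τ`» ⊣ «twist by `τ⁻¹`». [cite: GortzWedhorn2020, §(4.7) and Prop. 4.16] -/
def flat (N : SchemeOver L) (B : AbelianVariety L) (f : (bcFunctor L (AlongHom L τ.toRingHom)).obj N ⟶ B.X) : N ⟶ (B.conjugate τ.symm).X :=
  haveI := isIso_fst_twist τ N
  Over.homMk (pullback.lift (inv (pullback.fst N.hom (bcSpec L (AlongHom L τ.toRingHom))) ≫ f.left) N.hom (by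
      rw [Category.assoc, Over.w f, ← fst_comp_hom_comp_bcSpec_symm, IsIso.inv_hom_id_assoc]))
    (pullback.lift_snd _ _ _)

/-- `f♭ ≫ pr = pr⁻¹ ≫ f` on schemes. [cite: GortzWedhorn2020, Prop. 4.16] -/
theorem flat_left_comp_fst (N : SchemeOver L) (B : AbelianVariety L) (f : (bcFunctor L (AlongHom L τ.toRingHom)).obj N ⟶ B.X) :
    haveI := isIso_fst_twist τ N
    (flat τ N B f).left ≫ pullback.fst B.X.hom (bcSpec L (AlongHom L τ.symm.toRingHom)) =
      inv (pullback.fst N.hom (bcSpec L (AlongHom L τ.toRingHom))) ≫ f.left :=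
  pullback.lift_fst _ _ _

/-- **`(f♭)^τ ≫ c_B = f` on schemes**: `(f♭)^τ ≫ pr ≫ pr = f`. [cite: GortzWedhorn2020, Prop. 4.16] -/
theorem twist_map_flat_left (N : SchemeOver L) (B : AbelianVariety L) (f : (bcFunctor L (AlongHom L τ.toRingHom)).obj N ⟶ B.X) :
    ((bcFunctor L (AlongHom L τ.toRingHom)).map (flat τ N B f)).left ≫
        (pullback.fst ((B.conjugate τ.symm).X).hom (bcSpec L (AlongHom L τ.toRingHom)) ≫ pullback.fst B.X.hom (bcSpec L (AlongHom L τ.symm.toRingHom))) =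
      f.left := by
  haveI := isIso_fst_twist τ N
  rw [← Category.assoc, twist_map_left_comp_fst, Category.assoc, flat_left_comp_fst, IsIso.hom_inv_id_assoc]

/-- **Triviality along `δ` transports**: if `δ^τ ≫ f = 1` then `δ ≫ f♭ = 1`. [cite: Liu2021, §2.1 Prop. 2.2 (l. 1191: `ΔX ⊆ f⁻¹0_A`)] -/
theorem comp_flat_eq_one {X N : SchemeOver L} (δ : X ⟶ N) (B : AbelianVariety L) (f : (bcFunctor L (AlongHom L τ.toRingHom)).obj N ⟶ B.X)
    (hf : (bcFunctor L (AlongHom L τ.toRingHom)).map δ ≫ f = 1) : δ ≫ flat τ N B f = 1 := by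
  haveI := isIso_fst_twist τ N
  haveI := isIso_fst_twist τ X
  apply Over.OverMorphism.ext
  apply pullback.hom_ext
  · rw [Over.comp_left, Category.assoc, flat_left_comp_fst, one_conjugate_left_comp_fst']
    have h1 : ((bcFunctor L (AlongHom L τ.toRingHom)).map δ).left ≫ f.left =
        (1 : (bcFunctor L (AlongHom L τ.toRingHom)).obj X ⟶ B.X).left := congrArg CommaMorphism.left hf
    rw [twist_map_left_eq, one_left, ← fst_comp_hom_comp_bcSpec_symm, Category.assoc,
      Category.assoc, Category.assoc, Category.assoc] at h1
    exact (cancel_epi (pullback.fst X.hom (bcSpec L (AlongHom L τ.toRingHom)))).1 h1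
  · exact (Over.w (δ ≫ flat τ N B f)).trans (Over.w (1 : X ⟶ (B.conjugate τ.symm).X)).symm

end Bookkeeping

/-! ## §3 `Alb_{X^τ} = (Alb_X)^τ` (Def. 2.3 under conjugation) -/

namespace Albanese

open scoped MonObj Obj

variable {X Y : SchemeOver L}

/-- **Uniqueness half of the conjugated universal property**: two homomorphisms `(Alb_X)^τ → B` agreeing after `α_X^τ` are equal
(transport `ψ ↦ d⁻¹ ≫ ψ^{τ⁻¹} : Alb_X → B^{τ⁻¹}` along `d : ((Alb_X)^τ)^{τ⁻¹} ≅ Alb_X`, uniqueness of Def. 2.3 for `X`, faithfulness of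
conjugation). [cite: Liu2021, §2.1 Prop. 2.2 (l. 1190–1192) and Def. 2.3 (l. 1202–1208)] [cite: Milne2005ShimuraVarieties, §11 p. 108] -/
theorem conjugate_hom_ext (a : Albanese X) {B : AbelianVariety L} (ψ₁ ψ₂ : a.Alb.conjugate τ ⟶ B)
    (h : (bcFunctor L (AlongHom L τ.toRingHom)).map a.α ≫ ψ₁.hom.hom.hom =
      (bcFunctor L (AlongHom L τ.toRingHom)).map a.α ≫ ψ₂.hom.hom.hom) : ψ₁ = ψ₂ := by
  obtain ⟨d, hd⟩ := exists_iso_conjugate_conjugate_of_inverse_fst τ τ.symm τ.symm_apply_apply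
  haveI := isIso_fst_twist τ a.Alb.X
  haveI := isIso_fst_twist τ a.nabla.N
  -- `d⁻¹ ≫ pr_{τ⁻¹} = pr_τ⁻¹` on schemes
  have hdinv : AbelianVariety.Hom.toSchemeHom (d a.Alb).inv ≫
      pullback.fst ((a.Alb.conjugate τ).X).hom (bcSpec L (AlongHom L τ.symm.toRingHom)) =
        inv (pullback.fst a.Alb.X.hom (bcSpec L (AlongHom L τ.toRingHom))) := by
    apply IsIso.eq_inv_of_inv_hom_id
    rw [Category.assoc, ← hd a.Alb]
    change AbelianVariety.Hom.toSchemeHom ((d a.Alb).inv ≫ (d a.Alb).hom) = _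
    rw [Iso.inv_hom_id]
    rfl
  -- from `h`: `α ≫ pr⁻¹ ≫ ψ₁ = α ≫ pr⁻¹ ≫ ψ₂` on schemes
  have h' : a.α.left ≫ inv (pullback.fst a.Alb.X.hom (bcSpec L (AlongHom L τ.toRingHom))) ≫ ψ₁.hom.hom.hom.left =
      a.α.left ≫ inv (pullback.fst a.Alb.X.hom (bcSpec L (AlongHom L τ.toRingHom))) ≫ ψ₂.hom.hom.hom.left := by
    have h1 : ((bcFunctor L (AlongHom L τ.toRingHom)).map a.α).left ≫ ψ₁.hom.hom.hom.left =
        ((bcFunctor L (AlongHom L τ.toRingHom)).map a.α).left ≫ ψ₂.hom.hom.hom.left := congrArg CommaMorphism.left h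
    rw [twist_map_left_eq, Category.assoc, Category.assoc, Category.assoc, Category.assoc] at h1
    exact (cancel_epi (pullback.fst a.nabla.N.hom (bcSpec L (AlongHom L τ.toRingHom)))).1 h1
  -- the transported homomorphisms `Alb_X → B^{τ⁻¹}` agree after `α_X`
  have key : ∀ ψ : a.Alb.conjugate τ ⟶ B,
      (a.α ≫ ((d a.Alb).inv ≫ AbelianVariety.Hom.conjugate τ.symm ψ).hom.hom.hom).left ≫
          pullback.fst B.X.hom (bcSpec L (AlongHom L τ.symm.toRingHom)) =
        a.α.left ≫ inv (pullback.fst a.Alb.X.hom (bcSpec L (AlongHom L τ.toRingHom))) ≫ ψ.hom.hom.hom.left := by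
    intro ψ
    change (a.α.left ≫ AbelianVariety.Hom.toSchemeHom (d a.Alb).inv ≫
      AbelianVariety.Hom.toSchemeHom (AbelianVariety.Hom.baseChange (AlongHom L τ.symm.toRingHom) ψ)) ≫ _ = _
    rw [Category.assoc, Category.assoc, AbelianVariety.toSchemeHom_baseChange_comp_fst, ← Category.assoc _ (pullback.fst _ _),
      hdinv]
  have e12 : a.α ≫ ((d a.Alb).inv ≫ AbelianVariety.Hom.conjugate τ.symm ψ₁).hom.hom.hom =
      a.α ≫ ((d a.Alb).inv ≫ AbelianVariety.Hom.conjugate τ.symm ψ₂).hom.hom.hom := by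
    apply Over.OverMorphism.ext
    apply pullback.hom_ext
    · rw [key, key, h']
    · exact (Over.w _).trans (Over.w _).symm
  have e := a.hom_ext _ _ e12
  rw [cancel_epi] at e
  exact conjugate_hom_injective τ.symm ψ₁ ψ₂ e

/-- **The factorisation of the conjugated universal property**: for `f : (∇X)^τ → B` killing `Δ(X^τ)`, the homomorphism
`(Alb_X)^τ → B` is `(desc f♭)^τ ≫ c_B` with `f♭ : ∇X → B^{τ⁻¹}` the transported morphism (Def. 2.3 for `X`) and `c_B : (B^{τ⁻¹})^τ ≅ B`.
[cite: Liu2021, §2.1 Prop. 2.2 (l. 1191–1192) and Def. 2.3 (l. 1203)] [cite: Milne2005ShimuraVarieties, §11 p. 108] -/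
def conjugateDesc (a : Albanese X) {B : AbelianVariety L} (f : (bcFunctor L (AlongHom L τ.toRingHom)).obj a.nabla.N ⟶ B.X)
    (hf : (bcFunctor L (AlongHom L τ.toRingHom)).map a.nabla.diag ≫ f = 1) : a.Alb.conjugate τ ⟶ B :=
  AbelianVariety.Hom.conjugate τ (a.desc (flat τ a.nabla.N B f) (comp_flat_eq_one τ a.nabla.diag B f hf)) ≫
    (conjConjIso τ B).hom

/-- `α_X^τ ≫ ((desc f♭)^τ ≫ c_B) = f`. [cite: Liu2021, §2.1 Prop. 2.2 (l. 1190–1192) and Def. 2.3 (l. 1202–1208)] -/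
theorem twist_map_α_comp_conjugateDesc (a : Albanese X) {B : AbelianVariety L}
    (f : (bcFunctor L (AlongHom L τ.toRingHom)).obj a.nabla.N ⟶ B.X)
    (hf : (bcFunctor L (AlongHom L τ.toRingHom)).map a.nabla.diag ≫ f = 1) :
    (bcFunctor L (AlongHom L τ.toRingHom)).map a.α ≫ (conjugateDesc τ a f hf).hom.hom.hom = f := by
  apply Over.OverMorphism.ext
  change ((bcFunctor L (AlongHom L τ.toRingHom)).map a.α).left ≫
    ((bcFunctor L (AlongHom L τ.toRingHom)).map
        (a.desc (flat τ a.nabla.N B f) (comp_flat_eq_one τ a.nabla.diag B f hf)).hom.hom.hom).left ≫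
      AbelianVariety.Hom.toSchemeHom (conjConjIso τ B).hom = f.left
  rw [toSchemeHom_conjConjIso_hom, ← Category.assoc, ← Over.comp_left, ← Functor.map_comp, a.fac, twist_map_flat_left]

/-- **`Alb_{X^τ} := (Alb_X)^τ` with `α_{X^τ} := (α_X)^τ`** — the conjugate of an Albanese datum (Def. 2.3) is an Albanese datum of the
conjugate: `∇(X^τ) = (∇X)^τ` (§1), `Δ ≫ α = 0` is preserved by the monoidal twist functor, and corepresentability is transported through
the inverse twist (`conjugateDesc`, `conjugate_hom_ext`).  No descent and no [FGA VI 3.3 (iii)]: base change along an ISOMORPHISM.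
[cite: Liu2021, §2.1 Prop. 2.2–Def. 2.3 (l. 1190–1208)] [cite: Milne2005ShimuraVarieties, §11 p. 108 («the functor σ»)] -/
def conjugate (a : Albanese X) : Albanese ((bcFunctor L (AlongHom L τ.toRingHom)).obj X) where
  nabla := a.nabla.conjugate τ
  Alb := a.Alb.conjugate τ
  α := (bcFunctor L (AlongHom L τ.toRingHom)).map a.α
  diag_α := by
    have h := twist_map_one τ X a.Alb
    rw [← a.diag_α, Functor.map_comp] at h
    exact h
  desc f hf := conjugateDesc τ a f hf
  fac f hf := twist_map_α_comp_conjugateDesc τ a f hf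
  uniq f hf ψ h := conjugate_hom_ext τ a ψ _ (h.trans (twist_map_α_comp_conjugateDesc τ a f hf).symm)

/-- The abelian variety of the conjugated datum is `(Alb_X)^τ` (`rfl`). [cite: Liu2021, §2.1 Def. 2.3] -/
theorem conjugate_Alb (a : Albanese X) : (a.conjugate τ).Alb = a.Alb.conjugate τ := rfl

/-- Its Albanese morphism is `(α_X)^τ` (`rfl`). [cite: Liu2021, §2.1 Def. 2.3] -/
theorem conjugate_α (a : Albanese X) : (a.conjugate τ).α = (bcFunctor L (AlongHom L τ.toRingHom)).map a.α := rfl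

/-- Its `∇` is `(∇X)^τ` (`rfl`). [cite: Liu2021, §2.1 Def. 2.1 (1)] -/
theorem conjugate_nabla (a : Albanese X) : (a.conjugate τ).nabla = a.nabla.conjugate τ := rfl

/-- **`(Alb_u)^τ = Alb_{u^τ}`** for the conjugated Albanese data («the induced morphism `Alb_u` by the universal property», Def. 2.3
l. 1206–1208, is compatible with conjugation: both satisfy `α_Y^τ ≫ ψ = ∇(u^τ) ≫ α_X^τ`). [cite: Liu2021, §2.1 Def. 2.3, l. 1206–1208]
[cite: Milne2005ShimuraVarieties, §11 p. 108 («α ↦ σα»)] -/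
theorem conjugate_map (aY : Albanese Y) (aX : Albanese X) (u : Y ⟶ X) :
    AbelianVariety.Hom.conjugate τ (aY.map aX u) =
      (aY.conjugate τ).map (aX.conjugate τ) ((bcFunctor L (AlongHom L τ.toRingHom)).map u) := by
  refine Albanese.map_unique (aY.conjugate τ) (aX.conjugate τ) ((bcFunctor L (AlongHom L τ.toRingHom)).map u) _ ?_
  change (bcFunctor L (AlongHom L τ.toRingHom)).map aY.α ≫ (bcFunctor L (AlongHom L τ.toRingHom)).map (aY.map aX u).hom.hom.hom =
    (aY.nabla.conjugate τ).map (aX.nabla.conjugate τ) ((bcFunctor L (AlongHom L τ.toRingHom)).map u) ≫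
      (bcFunctor L (AlongHom L τ.toRingHom)).map aX.α
  rw [Nabla.conjugate_map, ← Functor.map_comp, Albanese.α_map, Functor.map_comp]

/-- **The comparison isomorphism of two Albanese data along the identity**: `Alb_{𝟙} : a.Alb ≅ a'.Alb` (functoriality, Def. 2.3).
[cite: Liu2021, §2.1 Def. 2.3, l. 1206–1208] -/
def isoOfEq (a a' : Albanese X) : a.Alb ≅ a'.Alb where
  hom := a.map a' (𝟙 X)
  inv := a'.map a (𝟙 X)
  hom_inv_id := by rw [← Albanese.map_comp, Category.comp_id, Albanese.map_id]
  inv_hom_id := by rw [← Albanese.map_comp, Category.comp_id, Albanese.map_id]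

/-- `isoOfEq` is natural: `Alb_u ≫ Alb_{𝟙} = Alb_{𝟙} ≫ Alb_u` for any two pairs of data (functoriality). [cite: Liu2021, §2.1 Def. 2.3, l. 1206–1208] -/
theorem map_comp_isoOfEq_hom (aY aY' : Albanese Y) (aX aX' : Albanese X) (u : Y ⟶ X) :
    aY.map aX u ≫ (isoOfEq aX aX').hom = (isoOfEq aY aY').hom ≫ aY'.map aX' u := by
  change aY.map aX u ≫ aX.map aX' (𝟙 X) = aY.map aY' (𝟙 Y) ≫ aY'.map aX' u
  rw [← Albanese.map_comp, ← Albanese.map_comp, Category.comp_id, Category.id_comp]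

end Albanese

end Literature.NumberTheory.Automorphic.Liu2021.AppendixC

end
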